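/-
Copyright (c) 2026 the pub-hodgecm-mathlib formalisation cell (harness21).  Prover seat hodgecm-mathlib-LH4-p04 (g8), req620 Track A «(D-RAM) FOUR-FRAME» squad
(STAGE-1b, row (2) of the piece `f_{T₊}`, the (β₂) road; dealer∕pen LH4-plan (g13) WORD #108 (4) ∕ WORD #112 (1), PEN #13∕#14: «(S4) β₂ ASSEMBLY», LH4-p04 lineage), 2026-09-04.
-/
import Summits.HodgeConjecture.HodgeConjecture.Theorems.F0P3cDyRamBlockGlueCount   -- ★ (LH4-p07 (g6)) O-Glue COUNT: brings ★ `…BlockGluePlane` (cone-index membership both ways, plane bridge), ★ p857312 glue fibration §1 (predicate-generic), ★ (z1-d) axis transport with labels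
import HarnessLib

/-!
# Crux `H413`, line LH4 «(D-RAM) FOUR-FRAME» — STAGE-1b, row (2), the (β₂) road, brick (S4-glue): «THE LABELLED GLUE COUNT»
# `#{M self-dual ∣ Γ·M = M, Q M} = #{axis ∧ Q} + Σ_{b=1}^{R} Σᶠ_{B₂ ∈ S_b(γ₂, u), Q̂_b(B₂)} #fibre(ι_W B₂, b)` for a FIBRE-CONSTANT label `Q`

Cell `hodgecm-mathlib` (D-0151), FLOOR 0, crux item H413 = `stmt-HodgeConjecture-24833`, route of record `HCCMUnconditional`; squad F0∕P3c∕LH4; lane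
`--supports stmt-HodgeConjecture-24833 --as helper` (count-neutral; pays NO tier-0 row).  THEOREMS ONLY (no `def`, no instance, no notation, no `sorry`, default heartbeats).
DATUM-FREE (`K` valued, `𝒪[K]` a PID, `σ` an isometric involution, `|ϖ| = exp(−1)`, block form with `H₂` hermitian of unit determinant, `|h| = 1`; no `|2|`, no residue field).

WHY.  After ★ `…CleanSgnDiffTypeTwoOfLiterals.hbeta2_of_literals` (this seat, (S4-lit)) the (β₂) letter of the piece `f_{T₊}` is the LITERAL letter `betaT2lit.letter.v1`
(ecb8685d): an identity between the LABELLED fixed-vertex counts `T₊ − T−′` of two unitary block elements `Γ = endoGL (γ₂, u)` (frames `block((Φ₂)_w, 1)` and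
`block(diag dg, η)`).  Every per-cell producer of the (β₂) road — (β₂-S) «GENERIC cone cells are literal-independent» ((S-1) ★ p860690, (S-2)), (β₂-H) «SPECIFIC cone cells are
balanced» (★ p860765 ∕ p860795 ∕ p860839, LH4-p09 (g9); flip units LH4-p11) — speaks of CONE CELLS `(b, B₂)` weighted by glue fibres; the UNLABELLED bridge from fixed
self-dual lattices to those cells is ★ O-Glue COUNT `…BlockGlueCount.ncard_fixed_selfDual_endoGL_eq_axis_add_sum` (`#F = #axis + Σ_b Σᶠ_{B₂ ∈ S_b} #fibre`), resting on «a glue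
cell is EMPTY or a WHOLE FIBRE — the gluing digit never enters the fixed criterion» (★ `…BlockGluePlane.mapGL_eq_of_comap_planeMatrix_mem_coneIndex` ∕
`comap_planeMatrix_mem_coneIndex_of_mapGL_eq`).  THIS FILE is its LABELLED twin, for any side condition `Q` on lattices that is FIBRE-CONSTANT on each tube layer `b ≥ 1`
(`hQ`: two self-dual lattices with the same tube coordinate `b` and the same `W`-part carry the same label) — which the `f_{T₊}` label IS near `1` (★ p860233
`latticeValueSetMod_endoGL_sub_one_glued_eq_plane`: on `M(B₂, u′·w₀)` the value set of `Γ − 1` reads `{N(u′)·⟨β′, (γ₂ − u)β′⟩ + (u − 1)(N(u′)⟨β′, β′⟩ + h·N(t))}` with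
`N(u′) ≡ r_{B₂} (ϖ^{2b})` and the `ϖ^{2b}`-tail below `ϖ^{m*}` once `v(λ − u), v(u − 1) ≥ m*`; F0P3-p01 (g36) GLUEFIBRE 91d9b231: «the label is constant on every glue fibre, both
E¹-classes alike» — typed in the sequel, not here):
* §1 `finsum_ncard_glueCell_sep_eq_finsum_mem_ncard_glueFibre` — LAYER COUNT, `b ≥ 1`: `Σᶠ_B #{M ∣ SD, Γ·M = M, Q M, tube b, M ∩ W = B} = Σᶠ_{B₂ ∈ S_b ∧ Q̂_b} #fibre(ι_W B₂, b)`,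
  where `S_b` is ★ p857377's cone index set VERBATIM (as in ★ O-Glue COUNT §5) and `Q̂_b(B₂) :⟺ ∃ M, SD ∧ M ∩ W = ι_W B₂ ∧ tube b ∧ Q M` (a witness; by `hQ` every member of the
  fibre then carries `Q`) — a labelled glue cell is EMPTY or a WHOLE FIBRE;
* §2 HEAD `ncard_fixed_selfDual_endoGL_sep_eq_axis_add_sum` — `#{M ∣ SD, Γ·M = M, Q M} = #{… ∧ e₁ ∈ M} + Σ_{b ∈ [1, R]} Σᶠ_{B₂ ∈ S_b ∧ Q̂_b} #fibre(ι_W B₂, b)` (★ p857312 §1 at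
  `P M := (Γ·M = M ∧ Q M)` ⊕ §1);
* §3 `ncard_fixed_selfDual_endoGL_sep_eq_plane_add_sum` — the same with the AXIS term read on the plane: `#{B₂ ∣ SD for H₂, γ₂·B₂ = B₂, Q₂ B₂}` for any plane label `Q₂` with
  `Q (latt ι(g₂, 1)) ↔ Q₂ (latt g₂)` (★ (z1-d) `ncard_selfDual_fixed_axis_eq` WITH labels).
Each fibre is ★ T2b `ncard_glueFibre_eq_natCard_normFibre`'s LHS (`= #Sol_{2b}(r_{B₂})`, left un-evaluated, as in ★ O-Glue COUNT); the translation of `(b, B₂, Q̂)` into the line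
model's `levelSet ∕ levelSetDep` letters is ★ `…BlockCensusOrderForm` business (the LABELLED order form = the next brick).  At `Q := True` §2 is ★ O-Glue COUNT's HEAD.
HONEST LABEL.  Count-neutral lattice bookkeeping; nothing printed is asserted; no census law is stated; (β₂) ∕ `betaT2lit` stay HYPOTHESES; `HC_CM` is proved only modulo the
7 printed citations (2 remaining named inputs: hLiu418 = `stmt-HodgeConjecture-24832`, h413 = `stmt-HodgeConjecture-24833`) until rung 0 closes.
## References
* [BruhatTits1972] F. Bruhat, J. Tits, *Groupes réductifs sur un corps local I*, Publ. Math. IHÉS 41 (1972), §10 (lattice models of the rank-one building; tube layers).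
* [Kottwitz1986BaseChangeUnits] R. E. Kottwitz, *Base change for unit elements of Hecke algebras*, Compositio Math. 60 (1986), §1 pp. 240–241.
* [Jacobowitz1962] R. Jacobowitz, *Hermitian forms over local fields*, Amer. J. Math. 84 (1962), §4 (dual lattices, gluing of modular components).
* [Rogawski1990] J. D. Rogawski, *Automorphic Representations of Unitary Groups in Three Variables*, Ann. of Math. Stud. 123 (1990), §4.8 Case (a) p. 53, §4.9 Prop. 4.9.1 (b) p. 55.
-/

set_option autoImplicit false

noncomputable section

namespace Summit.HodgeConjecture.HodgeConjecture.Cruxes.H413.F0P3cDyRamBlockGlueLabelledCount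

open scoped Valued WithZero Matrix MatrixGroups
open Literature.NumberTheory.Automorphic Literature.NumberTheory.Automorphic.HermitianLattice Literature.NumberTheory.Automorphic.UnitaryLatticeTree
open Literature.NumberTheory.Rogawski1990
open Summit.HodgeConjecture.HodgeConjecture.Cruxes.H413.F0P3cDyRamBlockGluePlane
open Summit.HodgeConjecture.HodgeConjecture.Cruxes.H413.F0P3cDyRamBlockGlueCount

variable {K : Type*} [Field K] [Valued K ℤᵐ⁰]

/-! ## §1 The tube layer `b ≥ 1` with a fibre-constant label: cells are empty or whole fibres -/

/-- **LABELLED LAYER COUNT.**  For a UNITARY block element `Γ = endoGL (γ₂, u)` (`|u| = 1`) with finite fixed self-dual family, a tube level `b ≥ 1`, and a side condition `Q`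
that is CONSTANT ON THE GLUE FIBRES of level `b` (`hQ`: self-dual `M, M′` with tube coordinate `b` and `M ∩ W = M′ ∩ W` ⇒ `Q M → Q M′`):
`Σᶠ_B #{M self-dual ∣ Γ·M = M, Q M, tube b, M ∩ W = B} = Σᶠ_{B₂ ∈ S_b ∧ Q̂_b} #{M self-dual ∣ M ∩ W = ι_W B₂, tube b}`, with `S_b` = ★ p857377's cone index set VERBATIM and
`Q̂_b(B₂) :⟺ ∃ M, SD ∧ M ∩ W = ι_W B₂ ∧ tube b ∧ Q M` — a labelled glue cell is empty or a whole fibre (★ `mapGL_eq_of_comap_planeMatrix_mem_coneIndex` ∕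
`comap_planeMatrix_mem_coneIndex_of_mapGL_eq` for the fixed clause, `hQ` for the label). [cite: BruhatTits1972, §10] [cite: Kottwitz1986BaseChangeUnits, §1 pp. 240–241] [cite: Jacobowitz1962, §4] -/
theorem finsum_ncard_glueCell_sep_eq_finsum_mem_ncard_glueFibre [IsPrincipalIdealRing 𝒪[K]] (σ : K →+* K) (hσ : ∀ a, σ (σ a) = a)
    (hvσ : ∀ a, Valued.v (σ a) = Valued.v a) {ϖ : K} (hϖ : Valued.v ϖ = WithZero.exp (-1 : ℤ))
    {H₂ : Matrix (Fin 2) (Fin 2) K} (hH₂ : IsUnit H₂.det) (hH₂σ : (H₂.map σ)ᵀ = H₂) {h : K} (hh : Valued.v h = 1)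
    (γ₂ : GL (Fin 2) K) (u : GL (Fin 1) K) (hΓ : endoGL (γ₂, u) ∈ unitaryGroupOfForm σ (!![H₂ 0 0, 0, H₂ 0 1; 0, h, 0; H₂ 1 0, 0, H₂ 1 1] : Matrix (Fin 3) (Fin 3) K))
    (hu : Valued.v ((u : Matrix (Fin 1) (Fin 1) K) 0 0) = 1)
    (hfin : {M : Submodule 𝒪[K] (Fin 3 → K) |
      IsSelfDualLattice σ ϖ (!![H₂ 0 0, 0, H₂ 0 1; 0, h, 0; H₂ 1 0, 0, H₂ 1 1] : Matrix (Fin 3) (Fin 3) K) M ∧ mapGL (endoGL (γ₂, u)) M = M}.Finite)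
    (Q : Submodule 𝒪[K] (Fin 3 → K) → Prop) {b : ℕ} (hb1 : 1 ≤ b)
    (hQ : ∀ M M' : Submodule 𝒪[K] (Fin 3 → K),
      IsSelfDualLattice σ ϖ (!![H₂ 0 0, 0, H₂ 0 1; 0, h, 0; H₂ 1 0, 0, H₂ 1 1] : Matrix (Fin 3) (Fin 3) K) M →
      IsSelfDualLattice σ ϖ (!![H₂ 0 0, 0, H₂ 0 1; 0, h, 0; H₂ 1 0, 0, H₂ 1 1] : Matrix (Fin 3) (Fin 3) K) M' →
      (∀ c : K, (Pi.single 1 c : Fin 3 → K) ∈ M ↔ Valued.v c ≤ Valued.v ϖ ^ b) → (∀ c : K, (Pi.single 1 c : Fin 3 → K) ∈ M' ↔ Valued.v c ≤ Valued.v ϖ ^ b) →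
      M ⊓ LinearMap.ker ((LinearMap.proj (1 : Fin 3) : (Fin 3 → K) →ₗ[K] K).restrictScalars 𝒪[K]) =
        M' ⊓ LinearMap.ker ((LinearMap.proj (1 : Fin 3) : (Fin 3 → K) →ₗ[K] K).restrictScalars 𝒪[K]) → Q M → Q M') :
    ∑ᶠ B : Submodule 𝒪[K] (Fin 3 → K),
        {M : Submodule 𝒪[K] (Fin 3 → K) |
          (IsSelfDualLattice σ ϖ (!![H₂ 0 0, 0, H₂ 0 1; 0, h, 0; H₂ 1 0, 0, H₂ 1 1] : Matrix (Fin 3) (Fin 3) K) M ∧ (mapGL (endoGL (γ₂, u)) M = M ∧ Q M)) ∧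
            (∀ c : K, (Pi.single 1 c : Fin 3 → K) ∈ M ↔ Valued.v c ≤ Valued.v ϖ ^ b) ∧
            M ⊓ LinearMap.ker ((LinearMap.proj (1 : Fin 3) : (Fin 3 → K) →ₗ[K] K).restrictScalars 𝒪[K]) = B}.ncard =
      ∑ᶠ B₂ ∈ {B : Submodule 𝒪[K] (Fin 2 → K) | ((∃ g : GL (Fin 2) K, B = latt (g : Matrix (Fin 2) (Fin 2) K)) ∧ mapGL γ₂ B = B ∧
          ∃ w₀ : Fin 2 → K, (∀ w, w ∈ B ↔ (w ∈ dualLatt σ H₂ B ∧ Valued.v (pairing σ H₂ w₀ w) ≤ 1)) ∧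
            (∀ w ∈ dualLatt σ H₂ B, ∃ (t : K) (a : Fin 2 → K), Valued.v t ≤ 1 ∧ a ∈ B ∧ w = t • w₀ + a) ∧
            Valued.v (pairing σ H₂ w₀ w₀) * Valued.v ϖ ^ (2 * b) = 1 ∧
            (γ₂ : Matrix (Fin 2) (Fin 2) K).mulVec w₀ - (u : Matrix (Fin 1) (Fin 1) K) 0 0 • w₀ ∈ B) ∧
          ∃ M : Submodule 𝒪[K] (Fin 3 → K), IsSelfDualLattice σ ϖ (!![H₂ 0 0, 0, H₂ 0 1; 0, h, 0; H₂ 1 0, 0, H₂ 1 1] : Matrix (Fin 3) (Fin 3) K) M ∧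
            M ⊓ LinearMap.ker ((LinearMap.proj (1 : Fin 3) : (Fin 3 → K) →ₗ[K] K).restrictScalars 𝒪[K]) =
              B.map ((Matrix.toLin' (!![1, 0; 0, 0; 0, 1] : Matrix (Fin 3) (Fin 2) K)).restrictScalars 𝒪[K]) ∧
            (∀ c : K, (Pi.single 1 c : Fin 3 → K) ∈ M ↔ Valued.v c ≤ Valued.v ϖ ^ b) ∧ Q M},
        {M : Submodule 𝒪[K] (Fin 3 → K) | IsSelfDualLattice σ ϖ (!![H₂ 0 0, 0, H₂ 0 1; 0, h, 0; H₂ 1 0, 0, H₂ 1 1] : Matrix (Fin 3) (Fin 3) K) M ∧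
            M ⊓ LinearMap.ker ((LinearMap.proj (1 : Fin 3) : (Fin 3 → K) →ₗ[K] K).restrictScalars 𝒪[K]) =
              B₂.map ((Matrix.toLin' (!![1, 0; 0, 0; 0, 1] : Matrix (Fin 3) (Fin 2) K)).restrictScalars 𝒪[K]) ∧
            ∀ c : K, (Pi.single 1 c : Fin 3 → K) ∈ M ↔ Valued.v c ≤ Valued.v ϖ ^ b}.ncard := by
  classical
  set H : Matrix (Fin 3) (Fin 3) K := !![H₂ 0 0, 0, H₂ 0 1; 0, h, 0; H₂ 1 0, 0, H₂ 1 1] with hHdef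
  set Wk : Submodule 𝒪[K] (Fin 3 → K) := LinearMap.ker ((LinearMap.proj (1 : Fin 3) : (Fin 3 → K) →ₗ[K] K).restrictScalars 𝒪[K]) with hWk
  set ι := ((Matrix.toLin' (!![1, 0; 0, 0; 0, 1] : Matrix (Fin 3) (Fin 2) K)).restrictScalars 𝒪[K]) with hι
  set S : Set (Submodule 𝒪[K] (Fin 2 → K)) := {B : Submodule 𝒪[K] (Fin 2 → K) | (∃ g : GL (Fin 2) K, B = latt (g : Matrix (Fin 2) (Fin 2) K)) ∧ mapGL γ₂ B = B ∧
          ∃ w₀ : Fin 2 → K, (∀ w, w ∈ B ↔ (w ∈ dualLatt σ H₂ B ∧ Valued.v (pairing σ H₂ w₀ w) ≤ 1)) ∧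
            (∀ w ∈ dualLatt σ H₂ B, ∃ (t : K) (a : Fin 2 → K), Valued.v t ≤ 1 ∧ a ∈ B ∧ w = t • w₀ + a) ∧
            Valued.v (pairing σ H₂ w₀ w₀) * Valued.v ϖ ^ (2 * b) = 1 ∧
            (γ₂ : Matrix (Fin 2) (Fin 2) K).mulVec w₀ - (u : Matrix (Fin 1) (Fin 1) K) 0 0 • w₀ ∈ B} with hSdef
  set SQ : Set (Submodule 𝒪[K] (Fin 2 → K)) := {B : Submodule 𝒪[K] (Fin 2 → K) | ((∃ g : GL (Fin 2) K, B = latt (g : Matrix (Fin 2) (Fin 2) K)) ∧ mapGL γ₂ B = B ∧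
          ∃ w₀ : Fin 2 → K, (∀ w, w ∈ B ↔ (w ∈ dualLatt σ H₂ B ∧ Valued.v (pairing σ H₂ w₀ w) ≤ 1)) ∧
            (∀ w ∈ dualLatt σ H₂ B, ∃ (t : K) (a : Fin 2 → K), Valued.v t ≤ 1 ∧ a ∈ B ∧ w = t • w₀ + a) ∧
            Valued.v (pairing σ H₂ w₀ w₀) * Valued.v ϖ ^ (2 * b) = 1 ∧
            (γ₂ : Matrix (Fin 2) (Fin 2) K).mulVec w₀ - (u : Matrix (Fin 1) (Fin 1) K) 0 0 • w₀ ∈ B) ∧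
          ∃ M : Submodule 𝒪[K] (Fin 3 → K), IsSelfDualLattice σ ϖ H M ∧ M ⊓ Wk = B.map ι ∧
            (∀ c : K, (Pi.single 1 c : Fin 3 → K) ∈ M ↔ Valued.v c ≤ Valued.v ϖ ^ b) ∧ Q M} with hSQdef
  have hSQ : ∀ B₂, B₂ ∈ SQ ↔ B₂ ∈ S ∧ ∃ M : Submodule 𝒪[K] (Fin 3 → K), IsSelfDualLattice σ ϖ H M ∧ M ⊓ Wk = B₂.map ι ∧
      (∀ c : K, (Pi.single 1 c : Fin 3 → K) ∈ M ↔ Valued.v c ≤ Valued.v ϖ ^ b) ∧ Q M := fun B₂ => Iff.rfl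
  -- the labelled tube layer `b` of the fixed family
  set L : Set (Submodule 𝒪[K] (Fin 3 → K)) := {M | (IsSelfDualLattice σ ϖ H M ∧ (mapGL (endoGL (γ₂, u)) M = M ∧ Q M)) ∧
      ∀ c : K, (Pi.single 1 c : Fin 3 → K) ∈ M ↔ Valued.v c ≤ Valued.v ϖ ^ b} with hL
  have hLfin : L.Finite := hfin.subset fun M hM => ⟨hM.1.1, hM.1.2.1⟩
  -- the left-hand side regroups `L` by the `W`-part: it is `#L`
  have h1 : (∑ᶠ B : Submodule 𝒪[K] (Fin 3 → K), {M : Submodule 𝒪[K] (Fin 3 → K) | (IsSelfDualLattice σ ϖ H M ∧ (mapGL (endoGL (γ₂, u)) M = M ∧ Q M)) ∧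
      (∀ c : K, (Pi.single 1 c : Fin 3 → K) ∈ M ↔ Valued.v c ≤ Valued.v ϖ ^ b) ∧ M ⊓ Wk = B}.ncard) = L.ncard := by
    rw [ncard_eq_finsum_ncard_fiber L hLfin fun M => M ⊓ Wk]
    refine finsum_congr fun B => ?_
    congr 1
    ext M
    simp only [hL, Set.mem_setOf_eq, and_assoc]
  -- the right-hand side regroups `L` by the plane part `ι_W⁻¹(M ∩ W)`
  rw [h1, ncard_eq_finsum_ncard_fiber L hLfin fun M => (M ⊓ Wk).comap ι, finsum_mem_def]
  refine finsum_congr fun B₂ => ?_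
  by_cases hS : B₂ ∈ SQ
  · -- over the labelled index set: the whole fibre is fixed and labelled, and it is exactly the `L`-fibre over `B₂`
    rw [Set.indicator_of_mem hS]
    obtain ⟨hS₀, M₀, hM₀SD, hM₀W, hM₀b, hM₀Q⟩ := (hSQ B₂).1 hS
    congr 1
    ext M
    simp only [hL, Set.mem_setOf_eq]
    constructor
    · rintro ⟨⟨⟨hSD, -⟩, htube⟩, hκ⟩
      refine ⟨hSD, ?_, htube⟩
      rw [← hκ, map_comap_planeMatrix_inf_ker]
    · rintro ⟨hSD, hW, htube⟩
      have hκ : (M ⊓ Wk).comap ι = B₂ := by rw [hW, Submodule.comap_map_eq_of_injective planeMatrix_injective]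
      have hS' := hS₀
      rw [← hκ] at hS'
      have hQM : Q M := hQ M₀ M hM₀SD hSD hM₀b htube (by rw [hM₀W, hW]) hM₀Q
      exact ⟨⟨⟨hSD, mapGL_eq_of_comap_planeMatrix_mem_coneIndex σ hσ hvσ hϖ hH₂ hH₂σ hh hSD hb1 htube γ₂ u hΓ hu hS', hQM⟩, htube⟩, hκ⟩
  · -- off the labelled index set: no fixed labelled member has this plane part
    rw [Set.indicator_of_notMem hS]
    have hempty : {M : Submodule 𝒪[K] (Fin 3 → K) | M ∈ L ∧ (M ⊓ Wk).comap ι = B₂} = ∅ := by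
      ext M
      simp only [hL, Set.mem_setOf_eq, Set.mem_empty_iff_false, iff_false]
      rintro ⟨⟨⟨hSD, hfix, hQM⟩, htube⟩, hκ⟩
      have hmem := comap_planeMatrix_mem_coneIndex_of_mapGL_eq σ hσ hvσ hϖ hH₂ hH₂σ hh hSD hb1 htube γ₂ u hΓ hu hfix
      rw [hκ] at hmem
      have hW : M ⊓ Wk = B₂.map ι := by rw [← hκ, map_comap_planeMatrix_inf_ker]
      exact hS ((hSQ B₂).2 ⟨hmem, M, hSD, hW, htube, hQM⟩)
    rw [hempty, Set.ncard_empty]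

/-! ## §2 HEAD — the labelled fixed self-dual lattices of a unitary block element, counted through the plane -/

/-- **THE LABELLED GLUE COUNT (HEAD).**  Block form `H = !![H₂ 0 0, 0, H₂ 0 1; 0, h, 0; H₂ 1 0, 0, H₂ 1 1]`, `Γ = endoGL (γ₂, u)` UNITARY for `H` (`|u| = 1`), fixed self-dual family
finite with tube coordinates `≤ R`, and a side condition `Q` constant on the glue fibres of every tube level `b ≥ 1`.  Then
`#{M ∣ SD, Γ·M = M, Q M} = #{M ∣ (SD, Γ·M = M, Q M) ∧ e₁ ∈ M} + Σ_{b ∈ [1, R]} Σᶠ_{B₂ ∈ S_b ∧ Q̂_b} #{M self-dual ∣ M ∩ W = ι_W B₂, tube b}` — ★ p857312 §1 at `P M := (Γ·M = M ∧ Q M)`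
⊕ §1.  At `Q := ⊤` this is ★ O-Glue COUNT's HEAD; each summand is ★ T2b's glue fibre `= #Sol_{2b}(r_{B₂})`.
[cite: Kottwitz1986BaseChangeUnits, §1 pp. 240–241] [cite: BruhatTits1972, §10] [cite: Jacobowitz1962, §4] [cite: Rogawski1990, §4.9 Prop. 4.9.1 (b) p. 55] -/
theorem ncard_fixed_selfDual_endoGL_sep_eq_axis_add_sum [IsPrincipalIdealRing 𝒪[K]] (σ : K →+* K) (hσ : ∀ a, σ (σ a) = a)
    (hvσ : ∀ a, Valued.v (σ a) = Valued.v a) {ϖ : K} (hϖ : Valued.v ϖ = WithZero.exp (-1 : ℤ))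
    {H₂ : Matrix (Fin 2) (Fin 2) K} (hH₂ : IsUnit H₂.det) (hH₂σ : (H₂.map σ)ᵀ = H₂) {h : K} (hh : Valued.v h = 1)
    (γ₂ : GL (Fin 2) K) (u : GL (Fin 1) K) (hΓ : endoGL (γ₂, u) ∈ unitaryGroupOfForm σ (!![H₂ 0 0, 0, H₂ 0 1; 0, h, 0; H₂ 1 0, 0, H₂ 1 1] : Matrix (Fin 3) (Fin 3) K))
    (hu : Valued.v ((u : Matrix (Fin 1) (Fin 1) K) 0 0) = 1) {R : ℕ}
    (hfin : {M : Submodule 𝒪[K] (Fin 3 → K) |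
      IsSelfDualLattice σ ϖ (!![H₂ 0 0, 0, H₂ 0 1; 0, h, 0; H₂ 1 0, 0, H₂ 1 1] : Matrix (Fin 3) (Fin 3) K) M ∧ mapGL (endoGL (γ₂, u)) M = M}.Finite)
    (hR : ∀ M : Submodule 𝒪[K] (Fin 3 → K), IsSelfDualLattice σ ϖ (!![H₂ 0 0, 0, H₂ 0 1; 0, h, 0; H₂ 1 0, 0, H₂ 1 1] : Matrix (Fin 3) (Fin 3) K) M →
      mapGL (endoGL (γ₂, u)) M = M → ∀ b : ℕ, (∀ c : K, (Pi.single 1 c : Fin 3 → K) ∈ M ↔ Valued.v c ≤ Valued.v ϖ ^ b) → b ≤ R)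
    (Q : Submodule 𝒪[K] (Fin 3 → K) → Prop)
    (hQ : ∀ (b : ℕ), 1 ≤ b → ∀ M M' : Submodule 𝒪[K] (Fin 3 → K),
      IsSelfDualLattice σ ϖ (!![H₂ 0 0, 0, H₂ 0 1; 0, h, 0; H₂ 1 0, 0, H₂ 1 1] : Matrix (Fin 3) (Fin 3) K) M →
      IsSelfDualLattice σ ϖ (!![H₂ 0 0, 0, H₂ 0 1; 0, h, 0; H₂ 1 0, 0, H₂ 1 1] : Matrix (Fin 3) (Fin 3) K) M' →
      (∀ c : K, (Pi.single 1 c : Fin 3 → K) ∈ M ↔ Valued.v c ≤ Valued.v ϖ ^ b) → (∀ c : K, (Pi.single 1 c : Fin 3 → K) ∈ M' ↔ Valued.v c ≤ Valued.v ϖ ^ b) →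
      M ⊓ LinearMap.ker ((LinearMap.proj (1 : Fin 3) : (Fin 3 → K) →ₗ[K] K).restrictScalars 𝒪[K]) =
        M' ⊓ LinearMap.ker ((LinearMap.proj (1 : Fin 3) : (Fin 3 → K) →ₗ[K] K).restrictScalars 𝒪[K]) → Q M → Q M') :
    {M : Submodule 𝒪[K] (Fin 3 → K) |
        IsSelfDualLattice σ ϖ (!![H₂ 0 0, 0, H₂ 0 1; 0, h, 0; H₂ 1 0, 0, H₂ 1 1] : Matrix (Fin 3) (Fin 3) K) M ∧ (mapGL (endoGL (γ₂, u)) M = M ∧ Q M)}.ncard =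
      {M : Submodule 𝒪[K] (Fin 3 → K) |
          (IsSelfDualLattice σ ϖ (!![H₂ 0 0, 0, H₂ 0 1; 0, h, 0; H₂ 1 0, 0, H₂ 1 1] : Matrix (Fin 3) (Fin 3) K) M ∧ (mapGL (endoGL (γ₂, u)) M = M ∧ Q M)) ∧
            (Pi.single 1 1 : Fin 3 → K) ∈ M}.ncard +
        ∑ b ∈ Finset.Icc 1 R, ∑ᶠ B₂ ∈ {B : Submodule 𝒪[K] (Fin 2 → K) | ((∃ g : GL (Fin 2) K, B = latt (g : Matrix (Fin 2) (Fin 2) K)) ∧ mapGL γ₂ B = B ∧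
            ∃ w₀ : Fin 2 → K, (∀ w, w ∈ B ↔ (w ∈ dualLatt σ H₂ B ∧ Valued.v (pairing σ H₂ w₀ w) ≤ 1)) ∧
              (∀ w ∈ dualLatt σ H₂ B, ∃ (t : K) (a : Fin 2 → K), Valued.v t ≤ 1 ∧ a ∈ B ∧ w = t • w₀ + a) ∧
              Valued.v (pairing σ H₂ w₀ w₀) * Valued.v ϖ ^ (2 * b) = 1 ∧
              (γ₂ : Matrix (Fin 2) (Fin 2) K).mulVec w₀ - (u : Matrix (Fin 1) (Fin 1) K) 0 0 • w₀ ∈ B) ∧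
            ∃ M : Submodule 𝒪[K] (Fin 3 → K), IsSelfDualLattice σ ϖ (!![H₂ 0 0, 0, H₂ 0 1; 0, h, 0; H₂ 1 0, 0, H₂ 1 1] : Matrix (Fin 3) (Fin 3) K) M ∧
              M ⊓ LinearMap.ker ((LinearMap.proj (1 : Fin 3) : (Fin 3 → K) →ₗ[K] K).restrictScalars 𝒪[K]) =
                B.map ((Matrix.toLin' (!![1, 0; 0, 0; 0, 1] : Matrix (Fin 3) (Fin 2) K)).restrictScalars 𝒪[K]) ∧
              (∀ c : K, (Pi.single 1 c : Fin 3 → K) ∈ M ↔ Valued.v c ≤ Valued.v ϖ ^ b) ∧ Q M},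
          {M : Submodule 𝒪[K] (Fin 3 → K) | IsSelfDualLattice σ ϖ (!![H₂ 0 0, 0, H₂ 0 1; 0, h, 0; H₂ 1 0, 0, H₂ 1 1] : Matrix (Fin 3) (Fin 3) K) M ∧
              M ⊓ LinearMap.ker ((LinearMap.proj (1 : Fin 3) : (Fin 3 → K) →ₗ[K] K).restrictScalars 𝒪[K]) =
                B₂.map ((Matrix.toLin' (!![1, 0; 0, 0; 0, 1] : Matrix (Fin 3) (Fin 2) K)).restrictScalars 𝒪[K]) ∧
              ∀ c : K, (Pi.single 1 c : Fin 3 → K) ∈ M ↔ Valued.v c ≤ Valued.v ϖ ^ b}.ncard := by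
  -- ★ p857312 §1: the partition of the labelled fixed family by (tube coordinate, `W`-part); then §1 per tube layer
  rw [ncard_selfDual_eq_ncard_axis_add_sum_finsum_ncard_glueFibre σ hvσ hϖ hH₂ hh (fun M => mapGL (endoGL (γ₂, u)) M = M ∧ Q M)
    (hfin.subset fun M hM => ⟨hM.1, hM.2.1⟩) (fun M hSD hP b hb => hR M hSD hP.1 b hb)]
  congr 1
  refine Finset.sum_congr rfl fun b hb => ?_
  exact finsum_ncard_glueCell_sep_eq_finsum_mem_ncard_glueFibre σ hσ hvσ hϖ hH₂ hH₂σ hh γ₂ u hΓ hu hfin Q (Finset.mem_Icc.1 hb).1 (hQ b (Finset.mem_Icc.1 hb).1)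

/-! ## §3 The axis term read on the plane (★ (z1-d) with labels) -/

/-- **THE LABELLED GLUE COUNT, AXIS ON THE PLANE.**  As §2, with the axis term transported to the plane by ★ (z1-d) `ncard_selfDual_fixed_axis_eq` for a plane label `Q₂` that reads
`Q` on the axis vertices (`hQ₂ : Q (latt ι(g₂, 1)) ↔ Q₂ (latt g₂)` for every `g₂`):
`#{M ∣ SD, Γ·M = M, Q M} = #{B₂ ∣ SD for H₂, γ₂·B₂ = B₂, Q₂ B₂} + Σ_{b ∈ [1, R]} Σᶠ_{B₂ ∈ S_b ∧ Q̂_b} #{M self-dual ∣ M ∩ W = ι_W B₂, tube b}`.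
[cite: Kottwitz1986BaseChangeUnits, §1 pp. 240–241] [cite: BruhatTits1972, §10] [cite: Jacobowitz1962, §4] [cite: Rogawski1990, §4.9 Prop. 4.9.1 (b) p. 55] -/
theorem ncard_fixed_selfDual_endoGL_sep_eq_plane_add_sum [IsPrincipalIdealRing 𝒪[K]] (σ : K →+* K) (hσ : ∀ a, σ (σ a) = a)
    (hvσ : ∀ a, Valued.v (σ a) = Valued.v a) {ϖ : K} (hϖ : Valued.v ϖ = WithZero.exp (-1 : ℤ))
    {H₂ : Matrix (Fin 2) (Fin 2) K} (hH₂ : IsUnit H₂.det) (hH₂σ : (H₂.map σ)ᵀ = H₂) {h : K} (hh : Valued.v h = 1)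
    (γ₂ : GL (Fin 2) K) (u : GL (Fin 1) K) (hΓ : endoGL (γ₂, u) ∈ unitaryGroupOfForm σ (!![H₂ 0 0, 0, H₂ 0 1; 0, h, 0; H₂ 1 0, 0, H₂ 1 1] : Matrix (Fin 3) (Fin 3) K))
    (hu : Valued.v ((u : Matrix (Fin 1) (Fin 1) K) 0 0) = 1) {R : ℕ}
    (hfin : {M : Submodule 𝒪[K] (Fin 3 → K) |
      IsSelfDualLattice σ ϖ (!![H₂ 0 0, 0, H₂ 0 1; 0, h, 0; H₂ 1 0, 0, H₂ 1 1] : Matrix (Fin 3) (Fin 3) K) M ∧ mapGL (endoGL (γ₂, u)) M = M}.Finite)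
    (hR : ∀ M : Submodule 𝒪[K] (Fin 3 → K), IsSelfDualLattice σ ϖ (!![H₂ 0 0, 0, H₂ 0 1; 0, h, 0; H₂ 1 0, 0, H₂ 1 1] : Matrix (Fin 3) (Fin 3) K) M →
      mapGL (endoGL (γ₂, u)) M = M → ∀ b : ℕ, (∀ c : K, (Pi.single 1 c : Fin 3 → K) ∈ M ↔ Valued.v c ≤ Valued.v ϖ ^ b) → b ≤ R)
    (Q : Submodule 𝒪[K] (Fin 3 → K) → Prop)
    (hQ : ∀ (b : ℕ), 1 ≤ b → ∀ M M' : Submodule 𝒪[K] (Fin 3 → K),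
      IsSelfDualLattice σ ϖ (!![H₂ 0 0, 0, H₂ 0 1; 0, h, 0; H₂ 1 0, 0, H₂ 1 1] : Matrix (Fin 3) (Fin 3) K) M →
      IsSelfDualLattice σ ϖ (!![H₂ 0 0, 0, H₂ 0 1; 0, h, 0; H₂ 1 0, 0, H₂ 1 1] : Matrix (Fin 3) (Fin 3) K) M' →
      (∀ c : K, (Pi.single 1 c : Fin 3 → K) ∈ M ↔ Valued.v c ≤ Valued.v ϖ ^ b) → (∀ c : K, (Pi.single 1 c : Fin 3 → K) ∈ M' ↔ Valued.v c ≤ Valued.v ϖ ^ b) →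
      M ⊓ LinearMap.ker ((LinearMap.proj (1 : Fin 3) : (Fin 3 → K) →ₗ[K] K).restrictScalars 𝒪[K]) =
        M' ⊓ LinearMap.ker ((LinearMap.proj (1 : Fin 3) : (Fin 3 → K) →ₗ[K] K).restrictScalars 𝒪[K]) → Q M → Q M')
    (Q₂ : Submodule 𝒪[K] (Fin 2 → K) → Prop)
    (hQ₂ : ∀ g₂ : GL (Fin 2) K, Q (latt ((endoGL (g₂, (1 : GL (Fin 1) K)) : GL (Fin 3) K) : Matrix (Fin 3) (Fin 3) K)) ↔ Q₂ (latt (g₂ : Matrix (Fin 2) (Fin 2) K))) :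
    {M : Submodule 𝒪[K] (Fin 3 → K) |
        IsSelfDualLattice σ ϖ (!![H₂ 0 0, 0, H₂ 0 1; 0, h, 0; H₂ 1 0, 0, H₂ 1 1] : Matrix (Fin 3) (Fin 3) K) M ∧ (mapGL (endoGL (γ₂, u)) M = M ∧ Q M)}.ncard =
      {B₂ : Submodule 𝒪[K] (Fin 2 → K) | IsSelfDualLattice σ ϖ H₂ B₂ ∧ mapGL γ₂ B₂ = B₂ ∧ Q₂ B₂}.ncard +
        ∑ b ∈ Finset.Icc 1 R, ∑ᶠ B₂ ∈ {B : Submodule 𝒪[K] (Fin 2 → K) | ((∃ g : GL (Fin 2) K, B = latt (g : Matrix (Fin 2) (Fin 2) K)) ∧ mapGL γ₂ B = B ∧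
            ∃ w₀ : Fin 2 → K, (∀ w, w ∈ B ↔ (w ∈ dualLatt σ H₂ B ∧ Valued.v (pairing σ H₂ w₀ w) ≤ 1)) ∧
              (∀ w ∈ dualLatt σ H₂ B, ∃ (t : K) (a : Fin 2 → K), Valued.v t ≤ 1 ∧ a ∈ B ∧ w = t • w₀ + a) ∧
              Valued.v (pairing σ H₂ w₀ w₀) * Valued.v ϖ ^ (2 * b) = 1 ∧
              (γ₂ : Matrix (Fin 2) (Fin 2) K).mulVec w₀ - (u : Matrix (Fin 1) (Fin 1) K) 0 0 • w₀ ∈ B) ∧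
            ∃ M : Submodule 𝒪[K] (Fin 3 → K), IsSelfDualLattice σ ϖ (!![H₂ 0 0, 0, H₂ 0 1; 0, h, 0; H₂ 1 0, 0, H₂ 1 1] : Matrix (Fin 3) (Fin 3) K) M ∧
              M ⊓ LinearMap.ker ((LinearMap.proj (1 : Fin 3) : (Fin 3 → K) →ₗ[K] K).restrictScalars 𝒪[K]) =
                B.map ((Matrix.toLin' (!![1, 0; 0, 0; 0, 1] : Matrix (Fin 3) (Fin 2) K)).restrictScalars 𝒪[K]) ∧
              (∀ c : K, (Pi.single 1 c : Fin 3 → K) ∈ M ↔ Valued.v c ≤ Valued.v ϖ ^ b) ∧ Q M},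
          {M : Submodule 𝒪[K] (Fin 3 → K) | IsSelfDualLattice σ ϖ (!![H₂ 0 0, 0, H₂ 0 1; 0, h, 0; H₂ 1 0, 0, H₂ 1 1] : Matrix (Fin 3) (Fin 3) K) M ∧
              M ⊓ LinearMap.ker ((LinearMap.proj (1 : Fin 3) : (Fin 3 → K) →ₗ[K] K).restrictScalars 𝒪[K]) =
                B₂.map ((Matrix.toLin' (!![1, 0; 0, 0; 0, 1] : Matrix (Fin 3) (Fin 2) K)).restrictScalars 𝒪[K]) ∧
              ∀ c : K, (Pi.single 1 c : Fin 3 → K) ∈ M ↔ Valued.v c ≤ Valued.v ϖ ^ b}.ncard := by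
  have hϖ0 : ϖ ≠ 0 := fun h0 => by rw [h0, map_zero] at hϖ; exact WithZero.coe_ne_zero hϖ.symm
  have hϖ1 : Valued.v ϖ ≤ 1 := by rw [hϖ, ← WithZero.exp_zero, WithZero.exp_le_exp]; norm_num
  rw [ncard_fixed_selfDual_endoGL_sep_eq_axis_add_sum σ hσ hvσ hϖ hH₂ hH₂σ hh γ₂ u hΓ hu hfin hR Q hQ]
  congr 1
  have e₁ : {M : Submodule 𝒪[K] (Fin 3 → K) |
        (IsSelfDualLattice σ ϖ (!![H₂ 0 0, 0, H₂ 0 1; 0, h, 0; H₂ 1 0, 0, H₂ 1 1] : Matrix (Fin 3) (Fin 3) K) M ∧ (mapGL (endoGL (γ₂, u)) M = M ∧ Q M)) ∧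
          (Pi.single 1 1 : Fin 3 → K) ∈ M} =
      {M : Submodule 𝒪[K] (Fin 3 → K) |
        IsSelfDualLattice σ ϖ (!![H₂ 0 0, 0, H₂ 0 1; 0, h, 0; H₂ 1 0, 0, H₂ 1 1] : Matrix (Fin 3) (Fin 3) K) M ∧ mapGL (endoGL (γ₂, u)) M = M ∧
          (Pi.single 1 1 : Fin 3 → K) ∈ M ∧ Q M} := by
    ext M
    simp only [Set.mem_setOf_eq]
    tauto
  rw [e₁]
  exact ncard_selfDual_fixed_axis_eq σ hvσ hϖ0 hϖ1 hH₂ hh γ₂ hu Q Q₂ hQ₂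

end Summit.HodgeConjecture.HodgeConjecture.Cruxes.H413.F0P3cDyRamBlockGlueLabelledCount

end
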